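import Literature.Geometry.Lorentzian.FinalEraPackage2
import HarnessLib

/-!
# Stub `stub_pairRecurs` (v2-S2) of line `dilated-leaves-virial-certificate` of crux `Capture`
# (stmt-FinalStateConjecture-10115): pairwise recurrence of dilation from registered dilated epochs

The line `dilated-leaves-virial-certificate` of the crux `Capture` (routes `BartnikGapSettling` /
`QuietWindowCapture`, summit `FinalStateConjecture`; skeleton
`Summits/FinalStateConjecture/FinalStateConjecture/Cruxes/Capture/Lines/dilated_leaves_virial_certificate.lean`,
v2) reads the crux hypothesis "an `ε`-fine near-Kerr leaf beyond every compact `K`" as a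
RECURRENCE CERTIFICATE.  In v2 of the skeleton the GR transfer "fine leaf ⇒ registered dilated
epoch of the final-era package" is a certificate delivered WITH the package by the era stub (S1,
open), in package clothing: for every `D₁`, `t₀` there are registration times `tᵣ i ≥ t₀` at which
every pair of worldlines of the package `p : FinalEraPackage₂ 𝒟` is `D₁`-dilated, across
registration events of slope `|tᵣ i − tᵣ j| ≤ θ‖ξᵢ(tᵣ i) − ξⱼ(tᵣ j)‖ + C₀` with `θ V < 1` (a
hyperboloidal leaf is space-like with asymptotically null slope; `V < 1` is the package's speed
bound).  This file proves the registered stub `stub_pairRecurs` (verbatim signature): such a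
package has PAIRWISE recurrence of dilation — every pair is `D'`-dilated at arbitrarily late
common (pair-dependent) flat times.  Proof (`pairRecurs_of_registeredEpochs`): at
`t := max (tᵣ i) (tᵣ j)` the earlier-registered hole has moved by at most `V|tᵣ i − tᵣ j|`
(the `V`-Lipschitz clause (W3) `FinalEraPackage₂.norm_sub_le`), so the separation is
`≥ (1 − θV)‖ξᵢ(tᵣ i) − ξⱼ(tᵣ j)‖ − V C₀`, and `D₁` is chosen accordingly.  Pure kinematics over
the package fields `V`, `T`, `ξ`, `V_nonneg`, `norm_sub_le`; no named facts, no definitions.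
(A COMMON dilated time for all pairs does not follow for `p.N ≥ 3` — two pairs may dilate in
anti-phase — which is why v2 states the conclusion pairwise; for `p.N ≤ 2` pairwise = common, a
three-line glue lemma of the skeleton.)

References: Dafermos–Luk arXiv:1710.01722, p. 8 (the final-era picture the package records); the
skeleton's module docstring for the role of the stub in `Capture_of`.
-/

-- the doubled `FinalStateConjecture.FinalStateConjecture` path component trips dupNamespace
set_option linter.dupNamespace false

noncomputable section

namespace Summit.FinalStateConjecture.FinalStateConjecture.Theorems.BartnikGapSettling.Capture

open Set Filter Function Topology
open scoped Manifold ContDiff ENNReal BigOperators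
open Literature.Geometry.Lorentzian

variable {X : Type} [TopologicalSpace X] [ChartedSpace E3 X] [IsManifold (𝓡 3) ∞ X]
  [ConnectedSpace X] {D : InitialDataSet (𝓡 3) X}

/-- **Registered dilated epochs ⇒ pairwise recurrence of dilation** (the kinematic core of stub
S2): if a rev-2 final-era package admits, for every `D₁` and `t₀`, registration times `tᵣ i ≥ t₀`
at which every pair is `D₁`-dilated across registration events of slope
`|tᵣ i − tᵣ j| ≤ θ‖ξᵢ(tᵣ i) − ξⱼ(tᵣ j)‖ + C₀` with `θV < 1`, then every pair is `D'`-dilated at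
arbitrarily late COMMON (pair-dependent) flat times: at `t := max (tᵣ i) (tᵣ j)` the earlier hole
has moved by at most `V|tᵣ i − tᵣ j|` (clause (W3)), so the separation is
`≥ (1 − θV)‖ξᵢ(tᵣ i) − ξⱼ(tᵣ j)‖ − V C₀`. [folklore] -/
theorem pairRecurs_of_registeredEpochs {𝒟 : CauchyDevelopment D} (p : FinalEraPackage₂ 𝒟)
    {θ C₀ : ℝ} (hθ : θ * p.V < 1)
    (hreg : ∀ D₁ t₀ : ℝ, ∃ tᵣ : Fin p.N → ℝ, (∀ i, t₀ ≤ tᵣ i) ∧ ∀ i j, i ≠ j →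
      |tᵣ i - tᵣ j| ≤ θ * ‖p.ξ i (tᵣ i) - p.ξ j (tᵣ j)‖ + C₀ ∧
        D₁ ≤ ‖p.ξ i (tᵣ i) - p.ξ j (tᵣ j)‖)
    {i j : Fin p.N} (hij : i ≠ j) (D' t₀ : ℝ) :
    ∃ t : ℝ, t₀ ≤ t ∧ D' ≤ ‖p.ξ i t - p.ξ j t‖ := by
  have hV := p.V_nonneg
  have hgap : 0 < 1 - θ * p.V := by linarith
  obtain ⟨tᵣ, htᵣ, H⟩ := hreg ((D' + p.V * C₀) / (1 - θ * p.V)) (max t₀ p.T)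
  obtain ⟨hslope, hdil⟩ := H i j hij
  set d := ‖p.ξ i (tᵣ i) - p.ξ j (tᵣ j)‖ with hd
  have hTi : p.T ≤ tᵣ i := (le_max_right _ _).trans (htᵣ i)
  have hTj : p.T ≤ tᵣ j := (le_max_right _ _).trans (htᵣ j)
  have h0i : t₀ ≤ tᵣ i := (le_max_left _ _).trans (htᵣ i)
  have h0j : t₀ ≤ tᵣ j := (le_max_left _ _).trans (htᵣ j)
  -- `(1 - θV) d - V C₀ ≥ D'`
  have hkey : D' ≤ d - p.V * (θ * d + C₀) := by
    have h1 : D' + p.V * C₀ ≤ (1 - θ * p.V) * d := by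
      rw [div_le_iff₀ hgap] at hdil
      linarith
    nlinarith
  rcases le_total (tᵣ i) (tᵣ j) with hle | hle
  · -- hole `i` registered first: compare at `t := tᵣ j`
    refine ⟨tᵣ j, h0j, ?_⟩
    have hmove : ‖p.ξ i (tᵣ j) - p.ξ i (tᵣ i)‖ ≤ p.V * (θ * d + C₀) := by
      have h1 := p.norm_sub_le i (tᵣ i) (tᵣ j) hTi hle
      have h2 : tᵣ j - tᵣ i ≤ θ * d + C₀ := by
        have := abs_sub_comm (tᵣ i) (tᵣ j) ▸ hslope
        linarith [le_abs_self (tᵣ j - tᵣ i)]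
      exact h1.trans (mul_le_mul_of_nonneg_left h2 hV)
    have htri : d - ‖p.ξ i (tᵣ j) - p.ξ i (tᵣ i)‖ ≤ ‖p.ξ i (tᵣ j) - p.ξ j (tᵣ j)‖ := by
      have h := norm_sub_norm_le (p.ξ i (tᵣ i) - p.ξ j (tᵣ j)) (p.ξ i (tᵣ i) - p.ξ i (tᵣ j))
      rw [norm_sub_rev (p.ξ i (tᵣ i)) (p.ξ i (tᵣ j))] at h
      have he : p.ξ i (tᵣ i) - p.ξ j (tᵣ j) - (p.ξ i (tᵣ i) - p.ξ i (tᵣ j)) =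
          p.ξ i (tᵣ j) - p.ξ j (tᵣ j) := by abel
      rwa [he] at h
    linarith
  · -- hole `j` registered first: compare at `t := tᵣ i`
    refine ⟨tᵣ i, h0i, ?_⟩
    have hmove : ‖p.ξ j (tᵣ i) - p.ξ j (tᵣ j)‖ ≤ p.V * (θ * d + C₀) := by
      have h1 := p.norm_sub_le j (tᵣ j) (tᵣ i) hTj hle
      have h2 : tᵣ i - tᵣ j ≤ θ * d + C₀ := by linarith [le_abs_self (tᵣ i - tᵣ j)]
      exact h1.trans (mul_le_mul_of_nonneg_left h2 hV)
    have htri : d - ‖p.ξ j (tᵣ i) - p.ξ j (tᵣ j)‖ ≤ ‖p.ξ i (tᵣ i) - p.ξ j (tᵣ i)‖ := by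
      have h := norm_sub_norm_le (p.ξ i (tᵣ i) - p.ξ j (tᵣ j)) (p.ξ j (tᵣ i) - p.ξ j (tᵣ j))
      have he : p.ξ i (tᵣ i) - p.ξ j (tᵣ j) - (p.ξ j (tᵣ i) - p.ξ j (tᵣ j)) =
          p.ξ i (tᵣ i) - p.ξ j (tᵣ i) := by abel
      rwa [he] at h
    linarith

/-- **Stub S2 of the line (v2), registered signature verbatim**: a rev-2 final-era package with
registered dilated epochs has pairwise recurrence of dilation. [folklore] -/
theorem stub_pairRecurs :
    ∀ (X : Type) [TopologicalSpace X] [ChartedSpace E3 X] [IsManifold (𝓡 3) ∞ X] [ConnectedSpace X]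
      (D : InitialDataSet (𝓡 3) X) (𝒟 : CauchyDevelopment D) (p : FinalEraPackage₂ 𝒟),
      (∃ θ C₀ : ℝ, θ * p.V < 1 ∧ ∀ D₁ t₀ : ℝ, ∃ tᵣ : Fin p.N → ℝ, (∀ i, t₀ ≤ tᵣ i) ∧
        ∀ i j, i ≠ j → |tᵣ i - tᵣ j| ≤ θ * ‖p.ξ i (tᵣ i) - p.ξ j (tᵣ j)‖ + C₀ ∧
          D₁ ≤ ‖p.ξ i (tᵣ i) - p.ξ j (tᵣ j)‖) →
      ∀ i j, i ≠ j → ∀ D' t₀ : ℝ, ∃ t : ℝ, t₀ ≤ t ∧ D' ≤ ‖p.ξ i t - p.ξ j t‖ := by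
  intro X _ _ _ _ D 𝒟 p hreg i j hij D' t₀
  obtain ⟨θ, C₀, hθ, hreg⟩ := hreg
  exact pairRecurs_of_registeredEpochs p hθ hreg hij D' t₀

end Summit.FinalStateConjecture.FinalStateConjecture.Theorems.BartnikGapSettling.Capture

end
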